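import Mathlib.Analysis.InnerProductSpace.Calculus
import Mathlib.Analysis.Calculus.Deriv.Slope
import Mathlib.Analysis.ODE.Gronwall
import Mathlib.Analysis.Normed.Module.FiniteDimension
import Mathlib.Topology.Order.DenselyOrdered
import HarnessLib

/-!
# Chang's Riccati decoupling of a slow–fast linear system with a DISSIPATIVE fast block:
# invariant ball, exact graph reduction, and the Duhamel remainder
# (Kokotović–Bensoussan–Blankenship 1987, Ch. 1 §2 eq. (2.17)–(2.20), (2.29) and Theorem 2.3 (Chang 1969/1972);
# §3 eq. (3.5)–(3.7))

Topic `Literature/Analysis/ODE` (namespace `Literature.Analysis.ODE.SlowFastRiccati`). Everything here is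
PROVED (no named fact, no definition, no instance, no `sorry`).

THE SETTING. Real inner-product spaces `E` (slow) and `F` (fast), `E` finite-dimensional; a linear
time-dependent block system on `[0, T]`
`x' = A₁₁(t) x + A₁₂(t) z`, `z' = A₂₁(t) x + A₂₂(t) z`,
with a `γ`-DISSIPATIVE fast block, `⟪A₂₂(t) z, z⟫ ≤ -γ ‖z‖²`, a slow block of norm `≤ s₀ < γ`, and
couplings of norm `≤ δ` with `8 δ² ≤ (γ - s₀)²`. Chang's RICCATI EQUATION for the graph `z = L x` of an
invariant manifold of the block system is
`L' = A₂₁ + A₂₂ L - L A₁₁ - L A₁₂ L`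
([KBB1987, Ch. 1 (2.29)] in the graph convention `η = z - L x` of (2.17)–(2.20); the transformed slow
equation is `ξ' = (A₁₁ + A₁₂ L) ξ`, (3.7)).

* `norm_le_invariantBall` (**G1, the invariant ball**): a solution with `‖L(0)‖ ≤ r := 2δ/(γ - s₀)` has
  `‖L(t)‖ ≤ r` on `[0, T]`. Chang's Theorem 2.3 [KBB1987] gives a bounded solution `L = D⁻¹C + O(ε)` under a
  Hurwitz hypothesis on the fast block; here the Hurwitz hypothesis (2.23) is replaced by energy
  dissipativity, which makes the radius explicit and dimension-free. PROOF (contact point): if `‖L‖`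
  first reaches `K ∈ (r, 1]` at `τ`, pick a unit `ξ` with `‖L(τ)ξ‖ = K` (finite dimension); then
  `d/dt ‖L ξ‖²(τ) ≥ 0`, while the equation gives `½ d/dt ‖Lξ‖² ≤ K (δ - (γ - s₀) K + δ K²) < 0`
  because `δ(1 + K²) ≤ 2δ = (γ - s₀) r < (γ - s₀) K`.
* `eq_graph_of_eq_graph_zero`, `hasDerivAt_reduced` (**G2, exact reduction** [KBB1987, §3 (3.5)–(3.7)]):
  along a solution of the Riccati equation, if `z(0) = L(0) x(0)` then `z(t) = L(t) x(t)` for all `t`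
  (the defect `η = z - L x` solves `η' = (A₂₂ - L A₁₂) η` from `0`; Grönwall), and `x` solves the
  reduced equation `x' = (A₁₁ + A₁₂ L) x`.
* `norm_sub_duhamel_le` (**G3, Duhamel remainder**): if `L₁' = A₂₁ + A₂₂ L₁`, `L₁(0) = L(0)`, then
  `‖L(t) - L₁(t)‖ ≤ r (s₀ + δ r)/γ` — the defect solves `ρ' = A₂₂ ρ - L A₁₁ - L A₁₂ L`, a `γ`-damped
  equation with forcing of norm `≤ r s₀ + δ r²` (contact-point argument for `‖ρ ξ‖`).

The three statements are typed exactly as the helper Props `RiccatiInvariantBall`, `GraphReduction`,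
`DuhamelRemainder` of the K1L plan (`Cruxes/LagrangianRenormalisationStep/SlowGraphSketch.lean`, crux idea
`chang-slow-graph`), universally quantified over the spaces.

## Contact-point lemmas (private)

`forall_lt_of_noContact` (a continuous `f` with `f(0) < K` and no admissible first contact stays `< K`
on `[0, T)`), `nonneg_of_contact` (at a first contact from below a derivative is `≥ 0`),
`le_on_Icc_of_le_on_Ico` (closedness at `T`), `exists_unit_norm_eq_opNorm` (the operator norm is
attained on the unit sphere of a finite-dimensional space).

## Mathlib / tree search

Mathlib: `norm_le_gronwallBound_of_norm_deriv_right_le`, `gronwallBound_ε0_δ0`, `HasDerivAt.norm_sq`,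
`HasDerivAt.clm_apply`/`clm_comp`, `hasDerivAt_iff_tendsto_slope`, `IsClosed.csInf_mem`,
`isCompact_sphere`, `ContinuousLinearMap.opNorm_le_of_unit_norm` (used). Tree: `SlowColumnSlaving.lean`
is the ONE-COLUMN (projective) Riccati of a skew-Hermitian ladder (`slowCone_invariant`, `hasDerivAt_ratio`);
the operator Riccati equation on abstract `E`, `F` is not in the tree (`lean search 'Riccati'`).

## References

* P. V. Kokotović, A. Bensoussan, G. L. Blankenship (eds.), *Singular Perturbations and Asymptotic Analysis
  in Control Systems*, LNCIS 90, Springer (1987), Ch. 1 (Kokotović, "Singular perturbation techniques in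
  control theory") §2 eq. (2.17)–(2.20), (2.29), Theorem 2.3; §3 eq. (3.3)–(3.7) (held:
  `book:kokotovic1987-singular-perturbations-asymptotic-analysis-control-systems`, PDF pp. 11–12).
  [`KokotovicBensoussanBlankenship1987`]
* K. W. Chang, *Singular perturbations of a general boundary value problem*, SIAM J. Math. Anal. 3 (1972)
  520–526. [`Chang1972`]
-/

noncomputable section

open Set Filter Topology
open scoped InnerProductSpace

namespace Literature.Analysis.ODE.SlowFastRiccati

/-! ## §0 Contact-point lemmas -/

/-- First exit: a function continuous on `[0, T]` with `f 0 < K` for which every first contact with the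
level `K` inside `(0, T)` is contradictory stays below `K` on `[0, T)`. [folklore] -/
private theorem forall_lt_of_noContact {f : ℝ → ℝ} {K T : ℝ} (hf : ContinuousOn f (Icc 0 T))
    (h0 : f 0 < K)
    (hcontact : ∀ τ ∈ Ioo 0 T, f τ = K → (∀ s ∈ Ico 0 τ, f s < K) → False) :
    ∀ t ∈ Ico 0 T, f t < K := by
  intro t ht
  by_contra hge
  push Not at hge
  set S : Set ℝ := Icc 0 t ∩ f ⁻¹' Ici K with hS
  have hSt : t ∈ S := ⟨⟨ht.1, le_rfl⟩, hge⟩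
  have hSne : S.Nonempty := ⟨t, hSt⟩
  have hSbdd : BddBelow S := ⟨0, fun s hs => hs.1.1⟩
  have hSclosed : IsClosed S :=
    (hf.mono (Icc_subset_Icc_right ht.2.le)).preimage_isClosed_of_isClosed isClosed_Icc isClosed_Ici
  set τ := sInf S with hτ
  have hτS : τ ∈ S := hSclosed.csInf_mem hSne hSbdd
  have hτt : τ ≤ t := csInf_le hSbdd hSt
  have hτ0 : 0 ≤ τ := hτS.1.1
  have hbelow : ∀ s ∈ Ico 0 τ, f s < K := by
    intro s hs
    by_contra hs'
    push Not at hs'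
    have hsS : s ∈ S := ⟨⟨hs.1, hs.2.le.trans hτt⟩, hs'⟩
    exact absurd (csInf_le hSbdd hsS) (not_le.2 hs.2)
  have hτpos : 0 < τ := by
    rcases hτ0.eq_or_lt with h | h
    · exact absurd hτS.2 (by rw [← h]; exact not_le.2 h0)
    · exact h
  -- f τ ≤ K by continuity from the left
  have hle : f τ ≤ K := by
    have hcw : ContinuousWithinAt f (Ico 0 τ) τ :=
      (hf τ ⟨hτ0, hτt.trans ht.2.le⟩).mono (fun s hs => ⟨hs.1, (hs.2.le.trans hτt).trans ht.2.le⟩)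
    have hmem : τ ∈ closure (Ico 0 τ) := by
      rw [closure_Ico hτpos.ne]; exact ⟨hτ0, le_rfl⟩
    haveI : (𝓝[Ico 0 τ] τ).NeBot := mem_closure_iff_nhdsWithin_neBot.1 hmem
    exact le_of_tendsto hcw.tendsto (eventually_nhdsWithin_of_forall fun s hs => (hbelow s hs).le)
  have heq : f τ = K := le_antisymm hle hτS.2
  exact hcontact τ ⟨hτpos, lt_of_le_of_lt hτt ht.2⟩ heq hbelow

/-- At a first contact from below the derivative is non-negative. [folklore] -/
private theorem nonneg_of_contact {f : ℝ → ℝ} {f' K τ a : ℝ} (ha : a < τ) (hf : HasDerivAt f f' τ)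
    (hτ : f τ = K) (hlt : ∀ s ∈ Ico a τ, f s < K) : 0 ≤ f' := by
  have ht : Tendsto (slope f τ) (𝓝[<] τ) (𝓝 f') :=
    (hasDerivAt_iff_tendsto_slope.1 hf).mono_left (nhdsWithin_mono _ fun s hs => ne_of_lt hs)
  refine ge_of_tendsto ht ?_
  filter_upwards [Ioo_mem_nhdsLT ha] with s hs
  rw [slope_def_field, hτ]
  exact div_nonneg_of_nonpos (sub_nonpos.2 (hlt s ⟨hs.1.le, hs.2⟩).le) (sub_nonpos.2 hs.2.le)

/-- Passing to the closed endpoint: `f ≤ K` on `[0, T)` and `f 0 ≤ K`, `f` continuous on `[0, T]`, give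
`f ≤ K` on `[0, T]`. [folklore] -/
private theorem le_on_Icc_of_le_on_Ico {f : ℝ → ℝ} {K T : ℝ} (hf : ContinuousOn f (Icc 0 T))
    (h0 : f 0 ≤ K) (h : ∀ t ∈ Ico 0 T, f t ≤ K) : ∀ t ∈ Icc 0 T, f t ≤ K := by
  intro t ht
  rcases ht.2.lt_or_eq with hlt | heq
  · exact h t ⟨ht.1, hlt⟩
  subst heq
  rcases ht.1.eq_or_lt with h0' | hpos
  · rw [← h0']; exact h0
  have hcw : ContinuousWithinAt f (Ico 0 t) t := (hf t ht).mono Ico_subset_Icc_self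
  have hmem : t ∈ closure (Ico 0 t) := by rw [closure_Ico hpos.ne]; exact ⟨ht.1, le_rfl⟩
  haveI : (𝓝[Ico 0 t] t).NeBot := mem_closure_iff_nhdsWithin_neBot.1 hmem
  exact le_of_tendsto hcw.tendsto (eventually_nhdsWithin_of_forall fun s hs => h s hs)

section Spaces

variable {E F : Type*} [NormedAddCommGroup E] [InnerProductSpace ℝ E]
  [NormedAddCommGroup F] [InnerProductSpace ℝ F]

/-- In a finite-dimensional nontrivial space the operator norm is attained on the unit sphere.
[folklore] -/
private theorem exists_unit_norm_eq_opNorm [FiniteDimensional ℝ E] [Nontrivial E] (L : E →L[ℝ] F) :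
    ∃ ξ : E, ‖ξ‖ = 1 ∧ ‖L ξ‖ = ‖L‖ := by
  have hc : IsCompact (Metric.sphere (0 : E) 1) := isCompact_sphere 0 1
  have hne : (Metric.sphere (0 : E) 1).Nonempty := NormedSpace.sphere_nonempty.2 zero_le_one
  obtain ⟨ξ, hξ, hmax⟩ := hc.exists_isMaxOn hne (L.continuous.norm.continuousOn)
  have hξ1 : ‖ξ‖ = 1 := by simpa using hξ
  refine ⟨ξ, hξ1, le_antisymm ?_ ?_⟩
  · calc ‖L ξ‖ ≤ ‖L‖ * ‖ξ‖ := L.le_opNorm ξ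
      _ = ‖L‖ := by rw [hξ1, mul_one]
  · refine ContinuousLinearMap.opNorm_le_of_unit_norm (norm_nonneg _) fun v hv => ?_
    exact hmax (show v ∈ Metric.sphere (0 : E) 1 by simpa using hv)

end Spaces

section Main

variable {E F : Type*} [NormedAddCommGroup E] [InnerProductSpace ℝ E] [FiniteDimensional ℝ E]
  [NormedAddCommGroup F] [InnerProductSpace ℝ F] [FiniteDimensional ℝ F]

/-! ## §1 (G1) The invariant ball of Chang's Riccati equation -/

/-- The radius algebra: `0 ≤ r = 2δ/(γ - s₀) < 1` under `8δ² ≤ (γ - s₀)²`. [folklore] -/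
private theorem radius_lt_one {γ δ s₀ : ℝ} (hsγ : s₀ < γ)
    (h8 : 8 * δ ^ 2 ≤ (γ - s₀) ^ 2) : 2 * δ / (γ - s₀) < 1 := by
  have hg : 0 < γ - s₀ := sub_pos.2 hsγ
  rw [div_lt_one hg]
  by_contra h
  push Not at h
  nlinarith [mul_le_mul_of_nonneg_left h hg.le, mul_le_mul_of_nonneg_left h (by linarith : 0 ≤ 2 * δ)]

omit [FiniteDimensional ℝ F] in
/-- **(G1) THE INVARIANT BALL.** For Chang's Riccati equation `L' = A₂₁ + A₂₂ L - L A₁₁ - L A₁₂ L` on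
`[0, T]` with a `γ`-dissipative fast block (`⟪A₂₂ z, z⟫ ≤ -γ‖z‖²`), `‖A₁₁‖ ≤ s₀ < γ`, couplings
`‖A₁₂‖, ‖A₂₁‖ ≤ δ` and `8δ² ≤ (γ - s₀)²`, the ball `‖L‖ ≤ 2δ/(γ - s₀)` is forward invariant.
[cite: KokotovicBensoussanBlankenship1987, Ch. 1 §2 eq. (2.29) and Theorem 2.3 (Chang), with the Hurwitz
hypothesis (2.23) replaced by energy dissipativity] -/
theorem norm_le_invariantBall
    (A₁₁ : ℝ → E →L[ℝ] E) (A₁₂ : ℝ → F →L[ℝ] E) (A₂₁ : ℝ → E →L[ℝ] F) (A₂₂ : ℝ → F →L[ℝ] F)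
    (L : ℝ → E →L[ℝ] F) (γ δ s₀ T : ℝ)
    (hγ : 0 < γ) (hδ : 0 ≤ δ) (hs₀ : 0 ≤ s₀) (hsγ : s₀ < γ) (h8 : 8 * δ ^ 2 ≤ (γ - s₀) ^ 2) (hT : 0 ≤ T)
    (hA₂₂ : ∀ t ∈ Icc 0 T, ∀ z : F, ⟪A₂₂ t z, z⟫_ℝ ≤ -γ * ‖z‖ ^ 2)
    (hA₁₁ : ∀ t ∈ Icc 0 T, ‖A₁₁ t‖ ≤ s₀) (hA₁₂ : ∀ t ∈ Icc 0 T, ‖A₁₂ t‖ ≤ δ)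
    (hA₂₁ : ∀ t ∈ Icc 0 T, ‖A₂₁ t‖ ≤ δ)
    (hL : ∀ t ∈ Ico 0 T, HasDerivAt L
      (A₂₁ t + (A₂₂ t).comp (L t) - (L t).comp (A₁₁ t) - ((L t).comp (A₁₂ t)).comp (L t)) t)
    (hLc : ContinuousOn L (Icc 0 T)) (hL0 : ‖L 0‖ ≤ 2 * δ / (γ - s₀)) :
    ∀ t ∈ Icc 0 T, ‖L t‖ ≤ 2 * δ / (γ - s₀) := by
  have _ := hγ; have _ := hs₀; have _ := hT
  set g : ℝ := γ - s₀ with hgdef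
  have hg : 0 < g := sub_pos.2 hsγ
  set r : ℝ := 2 * δ / g with hrdef
  have hr0 : 0 ≤ r := div_nonneg (by linarith) hg.le
  have hr1 : r < 1 := radius_lt_one hsγ h8
  have hgr : g * r = 2 * δ := by rw [hrdef]; field_simp
  have hnc : ContinuousOn (fun t => ‖L t‖) (Icc 0 T) := hLc.norm
  -- the case of a trivial slow space
  rcases subsingleton_or_nontrivial E with hE | hE
  · intro t _
    have : L t = 0 := ContinuousLinearMap.ext fun ξ => by
      rw [Subsingleton.elim ξ 0, map_zero, map_zero]
    rw [this, norm_zero]; exact hr0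
  -- main case: for every small ε, ‖L‖ < r + ε on [0, T)
  have key : ∀ ε, 0 < ε → ε ≤ 1 - r → ∀ t ∈ Ico 0 T, ‖L t‖ < r + ε := by
    intro ε hε hε1
    refine forall_lt_of_noContact hnc (by linarith) fun τ hτ hτK hbelow => ?_
    set K : ℝ := r + ε with hKdef
    have hK0 : 0 < K := by linarith
    have hK1 : K ≤ 1 := by linarith
    have hKr : r < K := by linarith
    have hτI : τ ∈ Icc 0 T := ⟨hτ.1.le, hτ.2.le⟩
    obtain ⟨ξ, hξ1, hξ⟩ := exists_unit_norm_eq_opNorm (L τ)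
    set w : F := L τ ξ with hwdef
    have hwK : ‖w‖ = K := by rw [hwdef, hξ]; exact hτK
    set L' : E →L[ℝ] F :=
      A₂₁ τ + (A₂₂ τ).comp (L τ) - (L τ).comp (A₁₁ τ) - ((L τ).comp (A₁₂ τ)).comp (L τ) with hL'def
    have hLτ : HasDerivAt L L' τ := hL τ ⟨hτ.1.le, hτ.2⟩
    have h1 : HasDerivAt (fun s => L s ξ) (L' ξ) τ := by
      simpa using hLτ.clm_apply (hasDerivAt_const τ ξ)
    have hu : HasDerivAt (fun s => ‖L s ξ‖ ^ 2) (2 * ⟪L τ ξ, L' ξ⟫_ℝ) τ := h1.norm_sq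
    have hbelow' : ∀ s ∈ Ico 0 τ, ‖L s ξ‖ ^ 2 < K ^ 2 := by
      intro s hs
      have h := hbelow s hs
      have hle : ‖L s ξ‖ ≤ ‖L s‖ := by
        calc ‖L s ξ‖ ≤ ‖L s‖ * ‖ξ‖ := (L s).le_opNorm ξ
          _ = ‖L s‖ := by rw [hξ1, mul_one]
      have hnn : 0 ≤ ‖L s ξ‖ := norm_nonneg _
      nlinarith
    have hnonneg : 0 ≤ 2 * ⟪L τ ξ, L' ξ⟫_ℝ :=
      nonneg_of_contact hτ.1 hu (by rw [← hwdef, hwK]) hbelow'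
    -- but the equation forces the derivative to be negative
    have hLn : ‖L τ‖ = K := hτK
    have hexp : ⟪L τ ξ, L' ξ⟫_ℝ = ⟪w, A₂₁ τ ξ⟫_ℝ + ⟪w, A₂₂ τ w⟫_ℝ - ⟪w, L τ (A₁₁ τ ξ)⟫_ℝ
        - ⟪w, L τ (A₁₂ τ w)⟫_ℝ := by
      simp only [hL'def, hwdef, FunLike.coe_sub, FunLike.coe_add, Pi.sub_apply,
        Pi.add_apply, ContinuousLinearMap.comp_apply, inner_sub_right, inner_add_right]
    have hb1 : ⟪w, A₂₁ τ ξ⟫_ℝ ≤ K * δ := by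
      refine (real_inner_le_norm _ _).trans ?_
      rw [hwK]
      refine mul_le_mul_of_nonneg_left ?_ hK0.le
      calc ‖A₂₁ τ ξ‖ ≤ ‖A₂₁ τ‖ * ‖ξ‖ := (A₂₁ τ).le_opNorm ξ
        _ ≤ δ := by rw [hξ1, mul_one]; exact hA₂₁ τ hτI
    have hb2 : ⟪w, A₂₂ τ w⟫_ℝ ≤ -γ * K ^ 2 := by
      rw [real_inner_comm, ← hwK]; exact hA₂₂ τ hτI w
    have hb3 : -(K * K * s₀) ≤ ⟪w, L τ (A₁₁ τ ξ)⟫_ℝ := by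
      have h := abs_real_inner_le_norm w (L τ (A₁₁ τ ξ))
      have h' : ‖w‖ * ‖L τ (A₁₁ τ ξ)‖ ≤ K * K * s₀ := by
        rw [hwK, mul_assoc]
        refine mul_le_mul_of_nonneg_left ?_ hK0.le
        calc ‖L τ (A₁₁ τ ξ)‖ ≤ ‖L τ‖ * ‖A₁₁ τ ξ‖ := (L τ).le_opNorm _
          _ ≤ K * s₀ := by
            rw [hLn]
            refine mul_le_mul_of_nonneg_left ?_ hK0.le
            calc ‖A₁₁ τ ξ‖ ≤ ‖A₁₁ τ‖ * ‖ξ‖ := (A₁₁ τ).le_opNorm ξ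
              _ ≤ s₀ := by rw [hξ1, mul_one]; exact hA₁₁ τ hτI
      linarith [neg_abs_le ⟪w, L τ (A₁₁ τ ξ)⟫_ℝ]
    have hb4 : -(K * K * (δ * K)) ≤ ⟪w, L τ (A₁₂ τ w)⟫_ℝ := by
      have h := abs_real_inner_le_norm w (L τ (A₁₂ τ w))
      have h' : ‖w‖ * ‖L τ (A₁₂ τ w)‖ ≤ K * K * (δ * K) := by
        rw [hwK, mul_assoc]
        refine mul_le_mul_of_nonneg_left ?_ hK0.le
        calc ‖L τ (A₁₂ τ w)‖ ≤ ‖L τ‖ * ‖A₁₂ τ w‖ := (L τ).le_opNorm _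
          _ ≤ K * (δ * K) := by
            rw [hLn]
            refine mul_le_mul_of_nonneg_left ?_ hK0.le
            calc ‖A₁₂ τ w‖ ≤ ‖A₁₂ τ‖ * ‖w‖ := (A₁₂ τ).le_opNorm w
              _ ≤ δ * K := by rw [hwK]; exact mul_le_mul_of_nonneg_right (hA₁₂ τ hτI) hK0.le
      linarith [neg_abs_le ⟪w, L τ (A₁₂ τ w)⟫_ℝ]
    have hsum : ⟪L τ ξ, L' ξ⟫_ℝ ≤ K * (δ - g * K + δ * K ^ 2) := by
      have hrhs : K * (δ - g * K + δ * K ^ 2) = K * δ + -γ * K ^ 2 + K * K * s₀ + K * K * (δ * K) := by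
        rw [hgdef]; ring
      rw [hexp, hrhs]; linarith
    have hneg : δ - g * K + δ * K ^ 2 < 0 := by
      have hK2 : K ^ 2 ≤ 1 := by nlinarith
      have h1 : δ * K ^ 2 ≤ δ := by nlinarith
      have h2 : g * r < g * K := mul_lt_mul_of_pos_left hKr hg
      linarith
    have : ⟪L τ ξ, L' ξ⟫_ℝ < 0 := hsum.trans_lt (mul_neg_of_pos_of_neg hK0 hneg)
    linarith
  -- conclusion on [0, T) and then on [0, T]
  have hIco : ∀ t ∈ Ico 0 T, ‖L t‖ ≤ r := by
    intro t ht
    refine le_of_forall_pos_lt_add fun ε hε => ?_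
    have h := key (min ε (1 - r)) (lt_min hε (by linarith)) (min_le_right _ _) t ht
    linarith [min_le_left ε (1 - r)]
  exact le_on_Icc_of_le_on_Ico hnc hL0 hIco

/-! ## §2 (G2) Exact reduction: the graph `z = L x` is invariant and carries `x' = (A₁₁ + A₁₂ L) x` -/

omit [FiniteDimensional ℝ E] [FiniteDimensional ℝ F] in
/-- **(G2) EXACT REDUCTION.** Along a solution `L` of Chang's Riccati equation, a solution `(x, z)` of the
block system with `z(0) = L(0) x(0)` stays on the graph, `z(t) = L(t) x(t)` on `[0, T]` (the defect
`η = z - L x` solves `η' = (A₂₂ - L A₁₂) η` from `η(0) = 0`), and `x` solves the REDUCED slow equation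
`x' = (A₁₁ + A₁₂ L) x` on `[0, T)`.
[cite: KokotovicBensoussanBlankenship1987, Ch. 1 §3 eq. (3.5)–(3.7) (the transformed slow equation)] -/
theorem eq_graph_of_eq_graph_zero
    (A₁₁ : ℝ → E →L[ℝ] E) (A₁₂ : ℝ → F →L[ℝ] E) (A₂₁ : ℝ → E →L[ℝ] F) (A₂₂ : ℝ → F →L[ℝ] F)
    (L : ℝ → E →L[ℝ] F) (x : ℝ → E) (z : ℝ → F) (T B : ℝ) (hT : 0 ≤ T)
    (hB : ∀ t ∈ Icc 0 T, ‖A₂₂ t‖ ≤ B ∧ ‖A₁₂ t‖ ≤ B ∧ ‖L t‖ ≤ B)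
    (hL : ∀ t ∈ Ico 0 T, HasDerivAt L
      (A₂₁ t + (A₂₂ t).comp (L t) - (L t).comp (A₁₁ t) - ((L t).comp (A₁₂ t)).comp (L t)) t)
    (hx : ∀ t ∈ Ico 0 T, HasDerivAt x (A₁₁ t (x t) + A₁₂ t (z t)) t)
    (hz : ∀ t ∈ Ico 0 T, HasDerivAt z (A₂₁ t (x t) + A₂₂ t (z t)) t)
    (hLc : ContinuousOn L (Icc 0 T)) (hxc : ContinuousOn x (Icc 0 T)) (hzc : ContinuousOn z (Icc 0 T))
    (h0 : z 0 = L 0 (x 0)) :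
    (∀ t ∈ Icc 0 T, z t = L t (x t)) ∧
      ∀ t ∈ Ico 0 T, HasDerivAt x ((A₁₁ t + (A₁₂ t).comp (L t)) (x t)) t := by
  have hB0 : 0 ≤ B := (norm_nonneg _).trans (hB 0 ⟨le_rfl, hT⟩).1
  -- the defect η = z - L x
  set η : ℝ → F := fun t => z t - L t (x t) with hηdef
  have hηd : ∀ t ∈ Ico 0 T, HasDerivAt η ((A₂₂ t - (L t).comp (A₁₂ t)) (η t)) t := by
    intro t ht
    have h := (hz t ht).sub ((hL t ht).clm_apply (hx t ht))
    refine h.congr_deriv ?_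
    simp only [hηdef, FunLike.coe_sub, FunLike.coe_add, Pi.sub_apply, Pi.add_apply,
      ContinuousLinearMap.comp_apply, map_add, map_sub]
    abel
  have hηc : ContinuousOn η (Icc 0 T) := hzc.sub (hLc.clm_apply hxc)
  have hbound : ∀ t ∈ Ico 0 T, ‖(A₂₂ t - (L t).comp (A₁₂ t)) (η t)‖ ≤ (B + B * B) * ‖η t‖ + 0 := by
    intro t ht
    have htI : t ∈ Icc 0 T := ⟨ht.1, ht.2.le⟩
    obtain ⟨h22, h12, hLB⟩ := hB t htI
    rw [add_zero]
    refine (ContinuousLinearMap.le_opNorm _ _).trans (mul_le_mul_of_nonneg_right ?_ (norm_nonneg _))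
    refine (norm_sub_le _ _).trans (add_le_add h22 ?_)
    exact (ContinuousLinearMap.opNorm_comp_le _ _).trans (mul_le_mul hLB h12 (norm_nonneg _) hB0)
  have hη0 : ‖η 0‖ ≤ 0 := by simp [hηdef, h0]
  have hgr := norm_le_gronwallBound_of_norm_deriv_right_le (f := η) (a := 0) (b := T) hηc
    (fun t ht => (hηd t ht).hasDerivWithinAt) hη0 hbound
  have hgraph : ∀ t ∈ Icc 0 T, z t = L t (x t) := by
    intro t ht
    have h := hgr t ht
    rw [gronwallBound_ε0_δ0] at h
    have : η t = 0 := norm_le_zero_iff.1 h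
    exact sub_eq_zero.1 this
  refine ⟨hgraph, fun t ht => ?_⟩
  refine (hx t ht).congr_deriv ?_
  rw [hgraph t ⟨ht.1, ht.2.le⟩]
  simp only [FunLike.coe_add, Pi.add_apply, ContinuousLinearMap.comp_apply]

/-! ## §3 (G3) The Duhamel remainder: the graph is its second-order part up to `r(s₀ + δr)/γ` -/

omit [FiniteDimensional ℝ F] in
/-- **(G3) THE DUHAMEL REMAINDER.** Under the hypotheses of `norm_le_invariantBall`, the solution `L₁`
of the LINEAR equation `L₁' = A₂₁ + A₂₂ L₁` with `L₁(0) = L(0)` satisfies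
`‖L(t) - L₁(t)‖ ≤ r (s₀ + δ r)/γ`, `r = 2δ/(γ - s₀)`: the defect `ρ = L - L₁` solves
`ρ' = A₂₂ ρ - L A₁₁ - L A₁₂ L`, a `γ`-damped equation with forcing of norm `≤ r s₀ + δ r²`.
[cite: KokotovicBensoussanBlankenship1987, Ch. 1 §2 Theorem 2.3 (Chang: `L = D⁻¹C + O(ε)`, the
leading-order identification of the graph), dissipative form] -/
theorem norm_sub_duhamel_le
    (A₁₁ : ℝ → E →L[ℝ] E) (A₁₂ : ℝ → F →L[ℝ] E) (A₂₁ : ℝ → E →L[ℝ] F) (A₂₂ : ℝ → F →L[ℝ] F)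
    (L L₁ : ℝ → E →L[ℝ] F) (γ δ s₀ T : ℝ)
    (hγ : 0 < γ) (hδ : 0 ≤ δ) (hs₀ : 0 ≤ s₀) (hsγ : s₀ < γ) (h8 : 8 * δ ^ 2 ≤ (γ - s₀) ^ 2) (hT : 0 ≤ T)
    (hA₂₂ : ∀ t ∈ Icc 0 T, ∀ z : F, ⟪A₂₂ t z, z⟫_ℝ ≤ -γ * ‖z‖ ^ 2)
    (hA₁₁ : ∀ t ∈ Icc 0 T, ‖A₁₁ t‖ ≤ s₀) (hA₁₂ : ∀ t ∈ Icc 0 T, ‖A₁₂ t‖ ≤ δ)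
    (hA₂₁ : ∀ t ∈ Icc 0 T, ‖A₂₁ t‖ ≤ δ)
    (hL : ∀ t ∈ Ico 0 T, HasDerivAt L
      (A₂₁ t + (A₂₂ t).comp (L t) - (L t).comp (A₁₁ t) - ((L t).comp (A₁₂ t)).comp (L t)) t)
    (hL₁ : ∀ t ∈ Ico 0 T, HasDerivAt L₁ (A₂₁ t + (A₂₂ t).comp (L₁ t)) t)
    (hLc : ContinuousOn L (Icc 0 T)) (hL₁c : ContinuousOn L₁ (Icc 0 T)) (h0 : L₁ 0 = L 0)
    (hL0 : ‖L 0‖ ≤ 2 * δ / (γ - s₀)) :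
    ∀ t ∈ Icc 0 T, ‖L t - L₁ t‖ ≤ (2 * δ / (γ - s₀)) * (s₀ + δ * (2 * δ / (γ - s₀))) / γ := by
  set r : ℝ := 2 * δ / (γ - s₀) with hrdef
  have hr0 : 0 ≤ r := div_nonneg (by linarith) (sub_pos.2 hsγ).le
  have hLr : ∀ t ∈ Icc 0 T, ‖L t‖ ≤ r :=
    norm_le_invariantBall A₁₁ A₁₂ A₂₁ A₂₂ L γ δ s₀ T hγ hδ hs₀ hsγ h8 hT hA₂₂ hA₁₁ hA₁₂ hA₂₁ hL hLc hL0
  set c : ℝ := r * s₀ + δ * r * r with hcdef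
  have hc0 : 0 ≤ c := by positivity
  have hcγ : 0 ≤ c / γ := div_nonneg hc0 hγ.le
  have htarget : r * (s₀ + δ * r) / γ = c / γ := by rw [hcdef]; ring
  rw [htarget]
  intro t ht
  refine ContinuousLinearMap.opNorm_le_of_unit_norm hcγ fun ξ hξ1 => ?_
  -- v(s) = (L s - L₁ s) ξ solves v' = A₂₂ v + F(s) ξ with ‖F(s) ξ‖ ≤ c
  set v : ℝ → F := fun s => (L s - L₁ s) ξ with hvdef
  have hvd : ∀ s ∈ Ico 0 T, HasDerivAt v
      (A₂₂ s (v s) + (-(L s (A₁₁ s ξ)) - L s (A₁₂ s (L s ξ)))) s := by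
    intro s hs
    have h := ((hL s hs).clm_apply (hasDerivAt_const s ξ)).sub
      ((hL₁ s hs).clm_apply (hasDerivAt_const s ξ))
    have h' : HasDerivAt v ((A₂₁ s + (A₂₂ s).comp (L s) - (L s).comp (A₁₁ s) -
        ((L s).comp (A₁₂ s)).comp (L s)) ξ + L s 0 - ((A₂₁ s + (A₂₂ s).comp (L₁ s)) ξ + L₁ s 0)) s :=
      h.congr_of_eventuallyEq (Filter.Eventually.of_forall fun y => by simp [hvdef])
    refine h'.congr_deriv ?_
    simp only [hvdef, FunLike.coe_sub, FunLike.coe_add, Pi.sub_apply, Pi.add_apply,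
      ContinuousLinearMap.comp_apply, map_sub, map_zero, add_zero]
    abel
  have hvc : ContinuousOn v (Icc 0 T) := (hLc.sub hL₁c).clm_apply continuousOn_const
  have hv0 : v 0 = 0 := by simp [hvdef, h0]
  have hforce : ∀ s ∈ Icc 0 T, ‖-(L s (A₁₁ s ξ)) - L s (A₁₂ s (L s ξ))‖ ≤ c := by
    intro s hs
    have hLs := hLr s hs
    have h1 : ‖L s (A₁₁ s ξ)‖ ≤ r * s₀ := by
      calc ‖L s (A₁₁ s ξ)‖ ≤ ‖L s‖ * ‖A₁₁ s ξ‖ := (L s).le_opNorm _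
        _ ≤ r * s₀ := mul_le_mul hLs (((A₁₁ s).le_opNorm ξ).trans
            (by rw [hξ1, mul_one]; exact hA₁₁ s hs)) (norm_nonneg _) hr0
    have h2 : ‖L s (A₁₂ s (L s ξ))‖ ≤ δ * r * r := by
      calc ‖L s (A₁₂ s (L s ξ))‖ ≤ ‖L s‖ * ‖A₁₂ s (L s ξ)‖ := (L s).le_opNorm _
        _ ≤ r * (δ * r) := by
          refine mul_le_mul hLs ?_ (norm_nonneg _) hr0
          calc ‖A₁₂ s (L s ξ)‖ ≤ ‖A₁₂ s‖ * ‖L s ξ‖ := (A₁₂ s).le_opNorm _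
            _ ≤ δ * r := mul_le_mul (hA₁₂ s hs) (((L s).le_opNorm ξ).trans
                (by rw [hξ1, mul_one]; exact hLs)) (norm_nonneg _) hδ
        _ = δ * r * r := by ring
    calc ‖-(L s (A₁₁ s ξ)) - L s (A₁₂ s (L s ξ))‖ ≤ ‖-(L s (A₁₁ s ξ))‖ + ‖L s (A₁₂ s (L s ξ))‖ :=
          norm_sub_le _ _
      _ ≤ r * s₀ + δ * r * r := by rw [norm_neg]; exact add_le_add h1 h2
  -- contact-point argument: ‖v‖ < c/γ + ε on [0, T)
  have hvn : ContinuousOn (fun s => ‖v s‖) (Icc 0 T) := hvc.norm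
  have key : ∀ ε, 0 < ε → ∀ s ∈ Ico 0 T, ‖v s‖ < c / γ + ε := by
    intro ε hε
    refine forall_lt_of_noContact hvn (by rw [hv0, norm_zero]; linarith) fun τ hτ hτK hbelow => ?_
    set κ : ℝ := c / γ + ε with hκdef
    have hκ0 : 0 < κ := by linarith
    have hvτ := hvd τ ⟨hτ.1.le, hτ.2⟩
    have hu : HasDerivAt (fun s => ‖v s‖ ^ 2)
        (2 * ⟪v τ, A₂₂ τ (v τ) + (-(L τ (A₁₁ τ ξ)) - L τ (A₁₂ τ (L τ ξ)))⟫_ℝ) τ := hvτ.norm_sq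
    have hbelow' : ∀ s ∈ Ico 0 τ, ‖v s‖ ^ 2 < κ ^ 2 := by
      intro s hs
      have h := hbelow s hs
      have hnn : 0 ≤ ‖v s‖ := norm_nonneg _
      nlinarith
    have hnonneg := nonneg_of_contact hτ.1 hu (by rw [hτK]) hbelow'
    have hτI : τ ∈ Icc 0 T := ⟨hτ.1.le, hτ.2.le⟩
    have hb1 : ⟪v τ, A₂₂ τ (v τ)⟫_ℝ ≤ -γ * κ ^ 2 := by
      rw [real_inner_comm, ← hτK]; exact hA₂₂ τ hτI (v τ)
    have hb2 : ⟪v τ, -(L τ (A₁₁ τ ξ)) - L τ (A₁₂ τ (L τ ξ))⟫_ℝ ≤ κ * c := by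
      refine (real_inner_le_norm _ _).trans ?_
      rw [hτK]
      exact mul_le_mul_of_nonneg_left (hforce τ hτI) hκ0.le
    have hsum : ⟪v τ, A₂₂ τ (v τ) + (-(L τ (A₁₁ τ ξ)) - L τ (A₁₂ τ (L τ ξ)))⟫_ℝ ≤ κ * (c - γ * κ) := by
      rw [inner_add_right]; nlinarith
    have hneg : c - γ * κ < 0 := by
      rw [hκdef, mul_add, mul_div_cancel₀ c hγ.ne']; nlinarith
    have : ⟪v τ, A₂₂ τ (v τ) + (-(L τ (A₁₁ τ ξ)) - L τ (A₁₂ τ (L τ ξ)))⟫_ℝ < 0 :=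
      hsum.trans_lt (mul_neg_of_pos_of_neg hκ0 hneg)
    linarith
  have hIco : ∀ s ∈ Ico 0 T, ‖v s‖ ≤ c / γ := fun s hs =>
    le_of_forall_pos_lt_add fun ε hε => key ε hε s hs
  have hIcc := le_on_Icc_of_le_on_Ico hvn (by rw [hv0, norm_zero]; exact hcγ) hIco
  exact hIcc t ht

end Main

end Literature.Analysis.ODE.SlowFastRiccati

end
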